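import Summits.MatrixMultiplication.MatrixMultiplication.Theses.SnSubsetDichotomy
import Literature.Computability.AlgebraicComplexity.CohnUmansTriangle

/-!
# Sketch (crux-ideate round 2, ideator 5) — Boolean-cube layer classes for `ThresholdSubsetTriples`

Points are the vectors of `V = Fin d → ZMod 2` (`n = 2^d`).  For a direction `v : V` a *cube layer along
`v`* is a permutation moving every point inside its fibre `{x, x + v}` by a rule constant on the fibre
(`σ x ∈ {x, x+v}`, `σ (x+v) = σ x + v`); the layers along `v` form an elementary abelian group
`E_v ≅ (ZMod 2)^{n/2}` (the base group of the hyperoctahedral group `C(t_v)`, `t_v = (· + v)`).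
For an ordered basis `v₀, …, v_{d-1}` and *layer codes* `C i ⊆ E_{v i}` the **cube-layer class** is the
product set `C_{d-1} ⋯ C₁ C₀` (apply `C₀` first).  First lemmas of the line (statements; the card's
`First lemma:` field):
* `CardExact`     — unique factorisation: `|C_{d-1} ⋯ C₀| = ∏ |C i|` (hence `|Ω| = n^{n/2}` for full layers);
* `DistanceLift`  — the class is a permutation code whose minimum Hamming distance is at least the minimum
                    distance inside the layer codes (no transposition / 3-cycle shadow once layers have
                    distance ≥ 4 as permutation codes, i.e. coset distance ≥ 2);
* `CubeLayerThreshold → ThresholdSubsetTriples` — the transfer (forget the structure; `n = 2^d` is cofinal).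
-/

set_option linter.dupNamespace false

namespace Summit.MatrixMultiplication.MatrixMultiplication.Cruxes.ThresholdSubsetTriples.Ideator5

open Finset
open Summit.MatrixMultiplication.MatrixMultiplication.Theses.SnSubsetDichotomy

variable {d : ℕ}

/-- The point set of the `d`-cube. -/
abbrev Cube (d : ℕ) := Fin d → ZMod 2

/-- `σ` is a cube layer along the direction `v`: it moves each point within its `v`-fibre by a rule
that is constant on the fibre. -/
def IsCubeLayer (v : Cube d) (σ : Equiv.Perm (Cube d)) : Prop :=
  ∀ x, (σ x = x ∨ σ x = x + v) ∧ σ (x + v) = σ x + v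

/-- The cube-layer class of an ordered family of layer codes: all products `c (d-1) * ⋯ * c 1 * c 0`
(the layer `c 0` acts first). -/
noncomputable def cubeClass (C : Fin d → Finset (Equiv.Perm (Cube d))) : Finset (Equiv.Perm (Cube d)) :=
  (Fintype.piFinset C).image fun c => (List.ofFn fun i : Fin d => c (Fin.rev i)).prod

/-- Layer codes along an ordered basis. -/
def IsLayerSystem (v : Fin d → Cube d) (C : Fin d → Finset (Equiv.Perm (Cube d))) : Prop :=
  LinearIndependent (ZMod 2) v ∧ ∀ i, ∀ σ ∈ C i, IsCubeLayer (v i) σ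

/-- FIRST LEMMA (a): unique factorisation — the class has exactly `∏ |C i|` elements. -/
def CardExact : Prop :=
  ∀ d : ℕ, ∀ v : Fin d → Cube d, ∀ C : Fin d → Finset (Equiv.Perm (Cube d)),
    IsLayerSystem v C → (cubeClass C).card = ∏ i, (C i).card

/-- Hamming distance of two permutations of the cube. -/
noncomputable def hdist (σ τ : Equiv.Perm (Cube d)) : ℕ :=
  (univ.filter fun x => σ x ≠ τ x).card

/-- FIRST LEMMA (b): distance lift — two distinct members of a cube-layer class are at Hamming distance
at least the minimum distance `D` inside the layer codes; equivalently every non-trivial right quotient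
`s' s⁻¹` moves at least `D` points (no transposition or 3-cycle in `Q(S)` once `D ≥ 4`). -/
def DistanceLift : Prop :=
  ∀ d : ℕ, ∀ v : Fin d → Cube d, ∀ C : Fin d → Finset (Equiv.Perm (Cube d)), ∀ D : ℕ,
    IsLayerSystem v C →
    (∀ i, ∀ σ ∈ C i, ∀ τ ∈ C i, σ ≠ τ → D ≤ hdist σ τ) →
    ∀ s ∈ cubeClass C, ∀ s' ∈ cubeClass C, s ≠ s' → D ≤ hdist s s'

/-- The design statement of the line: three cube-layer classes on three ordered bases of `(ZMod 2)^d`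
with the triple product property and volume above the threshold of `S_{2^d}`, cofinally in `d`. -/
def CubeLayerThreshold : Prop :=
  ∀ c : ℝ, 0 < c → ∀ d₀ : ℕ, ∃ d ≥ d₀,
    ∃ v₁ v₂ v₃ : Fin d → Cube d, ∃ C₁ C₂ C₃ : Fin d → Finset (Equiv.Perm (Cube d)),
      IsLayerSystem v₁ C₁ ∧ IsLayerSystem v₂ C₂ ∧ IsLayerSystem v₃ C₃ ∧
      Literature.Combinatorics.Additive.TripleProductProperty
        (cubeClass C₁) (cubeClass C₂) (cubeClass C₃) ∧
      ((2 ^ d).factorial : ℝ) ^ ((3 : ℝ) / 2) * Real.exp (-(c * Real.sqrt ((2 ^ d : ℕ) : ℝ))) <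
        (((cubeClass C₁).card * (cubeClass C₂).card * (cubeClass C₃).card : ℕ) : ℝ)

/-- The symmetric (triality) form: one class and a linear twist `g` of order three without non-zero fixed
points (scalar multiplication by `ω` on `(𝔽₄)^{d/2}`), `T = g S g⁻¹`, `U = g² S g⁻²`. -/
def CubeTrialityThreshold : Prop :=
  ∀ c : ℝ, 0 < c → ∀ d₀ : ℕ, ∃ d ≥ d₀, ∃ g : (Cube d) ≃ₗ[ZMod 2] (Cube d),
    g.trans (g.trans g) = LinearEquiv.refl (ZMod 2) (Cube d) ∧ (∀ x, g x = x → x = 0) ∧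
    ∃ v : Fin d → Cube d, ∃ C : Fin d → Finset (Equiv.Perm (Cube d)), IsLayerSystem v C ∧
      Literature.Combinatorics.Additive.TripleProductProperty (cubeClass C)
        ((cubeClass C).image fun s => g.toEquiv.trans (s.trans g.symm.toEquiv))
        ((cubeClass C).image fun s =>
          (g.trans g).toEquiv.trans (s.trans (g.trans g).symm.toEquiv)) ∧
      Real.sqrt ((2 ^ d).factorial : ℝ) * Real.exp (-(c * Real.sqrt ((2 ^ d : ℕ) : ℝ))) <
        ((cubeClass C).card : ℝ)

/-- TRANSFER (statement): a cube-layer threshold family is a threshold family of `S_n`, `n = 2^d`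
(transport along `Cube d ≃ Fin (2^d)`; the TPP and cardinalities are invariant under group isomorphism). -/
def CubeTransfer : Prop := CubeLayerThreshold → ThresholdSubsetTriples


/-- TRANSFER, proved: a cube-layer threshold family gives `ThresholdSubsetTriples` (transport along
`Cube d ≃ Fin (2^d)` with `Equiv.permCongrHom`; the TPP is preserved by injective homomorphisms,
tree lemma `CohnUmansTriangle.tpp_image`; `d ≤ 2^d` makes `n = 2^d` cofinal). -/
theorem cubeTransfer_holds : CubeTransfer := by
  classical
  intro h c hc n₀
  obtain ⟨d, hd, v₁, v₂, v₃, C₁, C₂, C₃, -, -, -, hT, hvol⟩ := h c hc n₀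
  have hcard : Fintype.card (Cube d) = 2 ^ d := by simp [Cube, Fintype.card_pi]
  let e : Cube d ≃ Fin (2 ^ d) := (Fintype.equivFin (Cube d)).trans (finCongr hcard)
  let φ : Equiv.Perm (Cube d) →* Equiv.Perm (Fin (2 ^ d)) := (Equiv.permCongrHom e).toMonoidHom
  have hφ : Function.Injective φ := (Equiv.permCongrHom e).injective
  refine ⟨2 ^ d, le_trans hd (Nat.lt_two_pow_self).le, (cubeClass C₁).image φ, (cubeClass C₂).image φ,
    (cubeClass C₃).image φ,
    Literature.Computability.AlgebraicComplexity.CohnUmansTriangle.tpp_image φ hφ hT, ?_⟩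
  simpa [Finset.card_image_of_injective _ hφ] using hvol

/-- Sanity: a cube layer is an involution (so `E_v` is an elementary abelian 2-group). -/
theorem IsCubeLayer.mul_self {v : Cube d} {σ : Equiv.Perm (Cube d)} (h : IsCubeLayer v σ) :
    σ * σ = 1 := by
  refine Equiv.ext fun x => ?_
  show σ (σ x) = x
  have h2 : ∀ a : ZMod 2, a + a = 0 := by decide
  have hvv : v + v = 0 := funext fun i => h2 (v i)
  rcases (h x).1 with hx | hx
  · rw [hx, hx]
  · rw [hx, (h x).2, hx, add_assoc, hvv, add_zero]

/-- Sanity: the identity is a layer along every direction, and layers along `v` commute with the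
translation `t_v = (· + v)` (they live in the hyperoctahedral group `C(t_v)`). -/
theorem IsCubeLayer.one (v : Cube d) : IsCubeLayer v 1 := fun x => ⟨Or.inl rfl, rfl⟩

theorem IsCubeLayer.comm_translate {v : Cube d} {σ : Equiv.Perm (Cube d)} (h : IsCubeLayer v σ)
    (x : Cube d) : σ (x + v) = σ x + v := (h x).2

end Summit.MatrixMultiplication.MatrixMultiplication.Cruxes.ThresholdSubsetTriples.Ideator5
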